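import Literature.Probability.Percolation.SiteMatchingPairInequality
import HarnessLib

/-!
# van den Berg–Ermakov's `p_c^site(ℤ²) > 0.556` (named fact) and the matching-lattice bound
# `p_c^site(ℤ²∗) < 0.444` conditional on it

Topic `Literature/Probability/Percolation`; one NAMED FACT (an unproved published theorem stated as a
`Prop`) and a theorem CONDITIONAL on it (no `sorry`).

J. van den Berg, A. Ermakov, *A new lower bound for the critical probability of site percolation on the
square lattice*, Random Structures & Algorithms 8 (1996) 199–212, Theorem 1.1: *"The critical
probability for site percolation on the square lattice is larger than 0.556."*  The proof (a refinement
of the Menshikov–Pelikh method: a growth process for percolation on the two-layer sublattice `𝕃` of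
the matching lattice `ℤ²∗`, compared child-by-child with site percolation on `ℤ²` at `1 - p` by stochastic
domination, the local comparison being 13 explicit inequalities at `p = 0.444`) is not in the tree; the
statement is recorded here as the named fact `VandenBergErmakov1996SquareSite` (users take it as a
hypothesis).  It is the best lower bound in print for `p_c^site(ℤ²)` (Monte Carlo value `≈ 0.5927`).

With the tree's half of the matching-pair identity, `p_c^site(ℤ²∗) ≤ 1 - p_c^site(ℤ²)`
(`siteCriticalProb_star_le_one_sub`, `SiteMatchingPairInequality.lean`; Russo 1981, Kesten 1982 §3.4 (3.89)),
it gives CONDITIONALLY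

* `siteCriticalProb_star_lt_of_vdBergErmakov`: **`p_c^site(ℤ²∗) < 0.444`** for the matching ("king")
  lattice of `ℤ²` — and hence, in the pcint lane (`Summits/…/PercNearOneGluingNoHeavyPcintSiteZ4King.lean`,
  via the covering `ℤ⁴ → ℤ²∗`), `p_c^site(ℤ⁴) < 0.444`.

## References

* [vandenBergErmakov1996] J. van den Berg, A. Ermakov, Random Struct. Alg. 8 (1996) 199–212, Thm. 1.1.
* [KestenPTM1982] H. Kesten, *Percolation theory for mathematicians* (1982), §3.4 Application (iv),
  eq. (3.89), p. 52 (`p_H(𝒢₀) = 1 - p_H(𝒢₀∗)`; proved by Russo 1981).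
-/

noncomputable section

namespace Literature.Probability.Percolation

open LatticeModels

/-- **van den Berg–Ermakov 1996, Theorem 1.1** (named fact, not proved in the tree): the site
percolation threshold of the square lattice satisfies `p_c^site(ℤ²) > 0.556`.
[cite: vandenBergErmakov1996, Theorem 1.1] -/
def VandenBergErmakov1996SquareSite : Prop :=
  (0.556 : ℝ) < siteCriticalProb (zdGraph 2) (0 : Site 2)

/-- **`p_c^site(ℤ²∗) < 0.444`, conditional on van den Berg–Ermakov's bound**: by
`p_c^site(ℤ²∗) ≤ 1 - p_c^site(ℤ²)` (Russo 1981; Kesten 1982, §3.4 (3.89)).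
[cite: KestenPTM1982, §3.4 Application (iv), eq. (3.89), p. 52] [cite: vandenBergErmakov1996, Theorem 1.1] -/
theorem siteCriticalProb_star_lt_of_vdBergErmakov (h : VandenBergErmakov1996SquareSite) :
    siteCriticalProb zdStarGraph (0 : Site 2) < 0.444 := by
  have h1 := siteCriticalProb_star_le_one_sub
  have h2 : (0.556 : ℝ) < siteCriticalProb (zdGraph 2) (0 : Site 2) := h
  linarith

end Literature.Probability.Percolation

end
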